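import Summits.Ventures.Crystal3D.Theorems.StickyWulffConstantStackingLiminfBadMass
import HarnessLib

/-!
# Occupied–vacant overlap `∫ v·u ≤ C·K·D` (step S4(iii) of stub (B) `stub_mollifiedUpper`, line `LayerChain` v4,
# crux `StackingLiminf`, stmt-Ventures-19145)

Route `StickyWulffConstant` of the venture `Summits/Ventures/Crystal3D` (cell `crystal3d-full`).
BLUEPRINT-v4B S4(iii) (planner cf-p1 g13): with `v = dens x K` the mollified density of a configuration `x` inside
`barlowStacking 1 √(2/3) σ` (indexed by `idx`) and `u = Σ_{t ∈ F, t ∉ idx(X)} φ_K(· − P_t)` the mollified VACANCY density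
over any finite index set `F`,
`∫ v·u ≤ (bumpConst/(√2 K³)) · #B·R·(12N − 2·numContacts x)` (**`integral_dens_mul_vacant_le`**), where
`#B·R = (2⌈3K⌉+1)(2⌈9K⌉+1)(2⌈6K⌉+1)(⌈3K⌉+⌈9K⌉+⌈6K⌉) ≍ K⁴`; i.e. `∫ v·u ≤ C·bumpConst·K·D`
(**`integral_dens_mul_vacant_le_linear`**, `C = 10⁵`).  Proof: expand the double sum; a term `∫ φ_K(·−x_i) φ_K(·−P_t)`
vanishes unless the two centres are within `2K` in every coordinate, and is `≤ sup φ_K · ∫ φ_K = bumpConst/(√2 K³)`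
otherwise; the near (occupied, vacant) pairs inject by `(i,t) ↦ (idx i, t − idx i)` into the occupied–vacant pairs of
the index window `B` (`idx_sub_le_of_near` with `L = K`), counted by `card_pairs_le` with `M ≤ 12N − 2C`
(`card_grid_boundary_add_le`).  This is the pair-count half of the skew bound `‖E‖₁ ≤ C(K·D + N/K)`; the other half
(rate-`1/K` lateral quadrature) is separate.
WHAT THIS IS NOT: not stub (B); rung F-C1 not moved.
-/

noncomputable section

namespace Summit.Ventures.Crystal3D.Theorems.PlateauHeight

open MeasureTheory Metric
open Literature.MathematicalPhysics.StatisticalMechanics (IsHaggSeq barlowPos barlowStacking)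
open Summit.Ventures.Crystal3D.Cruxes.StackingLiminf.LayerChainV4 (bump bumpConst dens)
open Summit.Ventures.Crystal3D.LayerChain (dot3)

/-- One overlap term: `∫ φ_K(y − p) φ_K(y − q) dy ≤ bumpConst/(√2 K³)`, and `= 0` unless `|p_l − q_l| < 2K` for all `l`. -/
theorem integral_bump_mul_bump_le {K : ℝ} (hK : 0 < K) (p q : Fin 3 → ℝ) :
    ∫ y : Fin 3 → ℝ, bump K (fun l => y l - p l) * bump K (fun l => y l - q l) ≤
      if (∀ l : Fin 3, |p l - q l| < 2 * K) then bumpConst / (Real.sqrt 2 * K ^ 3) else 0 := by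
  have hb : 0 < bumpConst := bumpConst_pos
  have hint : Integrable fun y : Fin 3 → ℝ => bump K (fun l => y l - q l) := by
    have e : (fun y : Fin 3 → ℝ => bump K (fun l => y l - q l)) = fun y => bump K (y - q) := rfl
    rw [e]
    exact ((continuous_bump K).integrable_of_hasCompactSupport (hasCompactSupport_bump hK)).comp_sub_right q
  split_ifs with h
  · calc ∫ y : Fin 3 → ℝ, bump K (fun l => y l - p l) * bump K (fun l => y l - q l)
        ≤ ∫ y : Fin 3 → ℝ, bumpConst / K ^ 3 * bump K (fun l => y l - q l) := by
          refine integral_mono_of_nonneg (ae_of_all _ fun y => mul_nonneg (bump_nonneg hK _) (bump_nonneg hK _))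
            (hint.const_mul _) (ae_of_all _ fun y => ?_)
          exact mul_le_mul_of_nonneg_right (bump_le hK _) (bump_nonneg hK _)
      _ = bumpConst / K ^ 3 * (1 / Real.sqrt 2) := by
          rw [integral_const_mul]
          congr 1
          have e : (fun y : Fin 3 → ℝ => bump K (fun l => y l - q l)) = fun y => bump K (y - q) := rfl
          rw [e, integral_sub_right_eq_self (bump K), rung_integral_bump K hK]
      _ = bumpConst / (Real.sqrt 2 * K ^ 3) := by field_simp
  · -- far apart: one of the two bumps vanishes at every point
    push Not at h
    obtain ⟨l, hl⟩ := h
    refine le_of_eq (integral_eq_zero_of_ae (Filter.Eventually.of_forall fun y => ?_))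
    simp only [Pi.zero_apply]
    by_cases hy : K ≤ |y l - p l|
    · rw [bump_eq_zero_of_coord hK l hy, zero_mul]
    · rw [not_le] at hy
      have : K ≤ |y l - q l| := by
        have t := abs_sub_abs_le_abs_sub (p l - q l) (p l - y l)
        rw [show p l - q l - (p l - y l) = y l - q l by ring, abs_sub_comm (p l) (y l)] at t
        linarith
      have hz : bump K (fun l => y l - q l) = 0 := bump_eq_zero_of_coord hK l this
      rw [hz, mul_zero]

/-- **Occupied–vacant overlap bound** `∫ v·u ≤ (bumpConst/(√2K³))·#B·R·(12N − 2C)`. -/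
theorem integral_dens_mul_vacant_le {σ : ℤ → ℤ} (hσ : IsHaggSeq σ) {N : ℕ}
    (x : Fin N → EuclideanSpace ℝ (Fin 3)) (hx : Function.Injective x)
    (hmem : ∀ i, x i ∈ barlowStacking 1 (Real.sqrt (2 / 3)) σ) (idx : Fin N → ℤ × ℤ × ℤ)
    (hidx : ∀ i, x i = barlowPos 1 (Real.sqrt (2 / 3)) σ (idx i).1 (idx i).2.1 (idx i).2.2)
    (F : Finset (ℤ × ℤ × ℤ)) {K : ℝ} (hK : 1 ≤ K) :
    ∫ y, dens x K y * (∑ t ∈ F.filter (fun t => t ∉ Finset.univ.image idx),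
        bump K (fun l => y l - (barlowPos 1 (Real.sqrt (2 / 3)) σ t.1 t.2.1 t.2.2) l)) ≤
      bumpConst / (Real.sqrt 2 * K ^ 3) *
        (((2 * ⌈3 * K⌉₊ + 1) * (2 * ⌈9 * K⌉₊ + 1) * (2 * ⌈6 * K⌉₊ + 1) *
            (⌈3 * K⌉₊ + ⌈9 * K⌉₊ + ⌈6 * K⌉₊) * (12 * N - 2 * Summit.Ventures.Crystal3D.numContacts x) : ℕ) : ℝ) := by
  classical
  have hK0 : 0 < K := by linarith
  have hb : 0 < bumpConst := bumpConst_pos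
  have hinj : Function.Injective idx := by
    intro i j hij; apply hx; rw [hidx i, hidx j, hij]
  set X : Finset (ℤ × ℤ × ℤ) := Finset.univ.image idx with hX
  set V : Finset (ℤ × ℤ × ℤ) := F.filter (fun t => t ∉ X) with hV
  set P : ℤ × ℤ × ℤ → (Fin 3 → ℝ) := fun t =>
    WithLp.ofLp (barlowPos 1 (Real.sqrt (2 / 3)) σ t.1 t.2.1 t.2.2) with hP
  -- integrability of the single terms
  have hφint : ∀ p : Fin 3 → ℝ, Integrable fun y : Fin 3 → ℝ => bump K (fun l => y l - p l) := by
    intro p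
    have e : (fun y : Fin 3 → ℝ => bump K (fun l => y l - p l)) = fun y => bump K (y - p) := rfl
    rw [e]
    exact ((continuous_bump K).integrable_of_hasCompactSupport (hasCompactSupport_bump hK0)).comp_sub_right p
  have hprodint : ∀ p q : Fin 3 → ℝ, Integrable fun y : Fin 3 → ℝ =>
      bump K (fun l => y l - p l) * bump K (fun l => y l - q l) := by
    intro p q
    refine Integrable.bdd_mul (c := bumpConst / K ^ 3) (hφint q) ?_ (ae_of_all _ fun y => ?_)
    · exact ((continuous_bump K).comp (continuous_pi fun l => by fun_prop)).aestronglyMeasurable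
    · rw [Real.norm_eq_abs, abs_of_nonneg (bump_nonneg hK0 _)]
      exact bump_le hK0 _
  -- expand the double sum
  have hexp : ∫ y, dens x K y * (∑ t ∈ V, bump K (fun l => y l - P t l)) =
      ∑ i, ∑ t ∈ V, ∫ y : Fin 3 → ℝ, bump K (fun l => y l - x i l) * bump K (fun l => y l - P t l) := by
    have e1 : ∀ y : Fin 3 → ℝ, dens x K y * (∑ t ∈ V, bump K (fun l => y l - P t l)) =
        ∑ i, ∑ t ∈ V, bump K (fun l => y l - x i l) * bump K (fun l => y l - P t l) := by
      intro y
      unfold dens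
      rw [Finset.sum_mul]
      refine Finset.sum_congr rfl fun i _ => ?_
      rw [Finset.mul_sum]
    simp_rw [e1]
    rw [integral_finsetSum _ fun i _ => ?_]
    · refine Finset.sum_congr rfl fun i _ => ?_
      rw [integral_finsetSum _ fun t _ => hprodint _ _]
    · exact integrable_finsetSum _ fun t _ => hprodint _ _
  rw [hexp]
  -- termwise bound
  have hterm : ∀ i (t : ℤ × ℤ × ℤ), ∫ y : Fin 3 → ℝ, bump K (fun l => y l - x i l) * bump K (fun l => y l - P t l) ≤
      if (∀ l : Fin 3, |x i l - P t l| < 2 * K) then bumpConst / (Real.sqrt 2 * K ^ 3) else 0 :=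
    fun i t => integral_bump_mul_bump_le hK0 _ _
  have hsum_le : ∑ i, ∑ t ∈ V, ∫ y : Fin 3 → ℝ, bump K (fun l => y l - x i l) * bump K (fun l => y l - P t l) ≤
      ∑ i, ∑ t ∈ V, (if (∀ l : Fin 3, |x i l - P t l| < 2 * K) then bumpConst / (Real.sqrt 2 * K ^ 3) else 0) :=
    Finset.sum_le_sum fun i _ => Finset.sum_le_sum fun t _ => hterm i t
  refine hsum_le.trans ?_
  -- count the near pairs
  set near : Fin N × (ℤ × ℤ × ℤ) → Prop := fun q => ∀ l : Fin 3, |x q.1 l - P q.2 l| < 2 * K with hnear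
  have hcount : ∑ i, ∑ t ∈ V, (if (∀ l : Fin 3, |x i l - P t l| < 2 * K) then
      bumpConst / (Real.sqrt 2 * K ^ 3) else 0) =
      (((Finset.univ ×ˢ V).filter near).card : ℝ) * (bumpConst / (Real.sqrt 2 * K ^ 3)) := by
    rw [← Finset.sum_product (s := Finset.univ) (t := V)
      (f := fun q => if (∀ l : Fin 3, |x q.1 l - P q.2 l| < 2 * K) then
        bumpConst / (Real.sqrt 2 * K ^ 3) else 0)]
    rw [← Finset.sum_filter, Finset.sum_const, nsmul_eq_mul]
  rw [hcount]
  -- the index window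
  set n₃ : ℕ := ⌈3 * K⌉₊ with hn₃
  set n₁ : ℕ := ⌈9 * K⌉₊ with hn₁
  set n₂ : ℕ := ⌈6 * K⌉₊ with hn₂
  set B : Finset (ℤ × ℤ × ℤ) := Finset.Icc (-(n₃ : ℤ)) n₃ ×ˢ
    (Finset.Icc (-(n₁ : ℤ)) n₁ ×ˢ Finset.Icc (-(n₂ : ℤ)) n₂) with hB
  have hBcard : B.card = (2 * n₃ + 1) * (2 * n₁ + 1) * (2 * n₂ + 1) := by
    rw [hB, Finset.card_product, Finset.card_product, Int.card_Icc, Int.card_Icc, Int.card_Icc]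
    have e : ∀ n : ℕ, ((n : ℤ) + 1 - -(n : ℤ)).toNat = 2 * n + 1 := fun n => by omega
    rw [e, e, e]; ring
  have hBR : ∀ Δ ∈ B, (|Δ.1| + |Δ.2.1| + |Δ.2.2|).toNat ≤ n₃ + n₁ + n₂ := by
    intro Δ hΔ
    rw [hB, Finset.mem_product, Finset.mem_product, Finset.mem_Icc, Finset.mem_Icc,
      Finset.mem_Icc] at hΔ
    have h1 : |Δ.1| ≤ n₃ := abs_le.2 ⟨hΔ.1.1, hΔ.1.2⟩
    have h2 : |Δ.2.1| ≤ n₁ := abs_le.2 ⟨hΔ.2.1.1, hΔ.2.1.2⟩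
    have h3 : |Δ.2.2| ≤ n₂ := abs_le.2 ⟨hΔ.2.2.1, hΔ.2.2.2⟩
    omega
  set M : ℕ := 12 * N - 2 * Summit.Ventures.Crystal3D.numContacts x with hM
  have hMb : ∀ u : ℤ × ℤ × ℤ, |u.1| + |u.2.1| + |u.2.2| = 1 →
      (X.filter fun a => a + u ∉ X).card ≤ M := by
    intro u hu
    have := card_grid_boundary_add_le hσ x hx hmem idx hidx u hu
    rw [← hX] at this
    omega
  have hpairs := card_pairs_le X B (n₃ + n₁ + n₂) M hBR hMb
  -- injection of near pairs into the window pairs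
  set Φ : Fin N × (ℤ × ℤ × ℤ) → (ℤ × ℤ × ℤ) × (ℤ × ℤ × ℤ) := fun q => (idx q.1, q.2 - idx q.1) with hΦ
  have hΦinj : Function.Injective Φ := by
    intro q q' h
    simp only [hΦ, Prod.mk.injEq] at h
    have h1 : q.1 = q'.1 := hinj h.1
    refine Prod.ext h1 ?_
    have := h.2
    rw [h1] at this
    exact sub_left_injective this
  have hsub : ((Finset.univ ×ˢ V).filter near).image Φ ⊆ (X ×ˢ B).filter fun q => q.1 + q.2 ∉ X := by
    intro q hq
    rw [Finset.mem_image] at hq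
    obtain ⟨⟨i, t⟩, hit, rfl⟩ := hq
    rw [Finset.mem_filter, Finset.mem_product] at hit
    obtain ⟨⟨_, htV⟩, hnr⟩ := hit
    rw [hV, Finset.mem_filter] at htV
    rw [Finset.mem_filter, Finset.mem_product]
    refine ⟨⟨Finset.mem_image_of_mem _ (Finset.mem_univ i), ?_⟩, by simpa [hΦ] using htV.2⟩
    -- the displacement lies in the window
    have hnr' : ∀ l : Fin 3, |x i l - P t l| < 2 * K := hnr
    have h2 := hnr' 2
    have h0 := hnr' 0
    have h1 := hnr' 1
    rw [hP, hidx i, abs_sub_comm] at h2 h0 h1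
    obtain ⟨dk, da, db⟩ := idx_sub_le_of_near hσ hK le_rfl (idx i).1 (idx i).2.1 (idx i).2.2
      t.1 t.2.1 t.2.2 h2 (by linarith) (by linarith)
    have dk' : |((t.1 - (idx i).1 : ℤ) : ℝ)| ≤ 3 * K := by push_cast; exact dk
    have da' : |((t.2.1 - (idx i).2.1 : ℤ) : ℝ)| ≤ 9 * K := by push_cast; exact da
    have db' : |((t.2.2 - (idx i).2.2 : ℤ) : ℝ)| ≤ 6 * K := by push_cast; exact db
    simp only [hΦ]
    rw [hB, Finset.mem_product, Finset.mem_product]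
    exact ⟨mem_Icc_of_abs_le dk', mem_Icc_of_abs_le da', mem_Icc_of_abs_le db'⟩
  have hcard_le : ((Finset.univ ×ˢ V).filter near).card ≤ B.card * (n₃ + n₁ + n₂) * M := by
    calc ((Finset.univ ×ˢ V).filter near).card
        = (((Finset.univ ×ˢ V).filter near).image Φ).card := (Finset.card_image_of_injective _ hΦinj).symm
      _ ≤ ((X ×ˢ B).filter fun q => q.1 + q.2 ∉ X).card := Finset.card_le_card hsub
      _ ≤ _ := hpairs
  rw [hBcard] at hcard_le
  have hc : 0 ≤ bumpConst / (Real.sqrt 2 * K ^ 3) := by positivity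
  calc ((((Finset.univ ×ˢ V).filter near).card : ℕ) : ℝ) * (bumpConst / (Real.sqrt 2 * K ^ 3))
      ≤ (((2 * n₃ + 1) * (2 * n₁ + 1) * (2 * n₂ + 1) * (n₃ + n₁ + n₂) * M : ℕ) : ℝ) *
          (bumpConst / (Real.sqrt 2 * K ^ 3)) :=
        mul_le_mul_of_nonneg_right (by exact_mod_cast hcard_le) hc
    _ = _ := by rw [mul_comm]

end Summit.Ventures.Crystal3D.Theorems.PlateauHeight

end
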